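import Literature.AlgebraicGeometry.Motives.TensorAffineOpenChart
import Literature.AlgebraicGeometry.Motives.TensorRegularPair
import Literature.AlgebraicGeometry.Motives.VarietiesRegularProofs
import Literature.AlgebraicGeometry.Motives.VarietiesGeometricallyIntegralProofs
import Literature.AlgebraicGeometry.Motives.SegreEmbedding
import Literature.AlgebraicGeometry.Resolution.BlowupSmoothProjective
import Literature.AlgebraicGeometry.Resolution.MarkedIdealsLemmas
import Literature.AlgebraicGeometry.Resolution.BlowupsRelativeCartier
import HarnessLib

/-!
# The product centre `Y₁ × Y₂ ⊂ X₁ × X₂` of two closed subschemes: charts, regularity, blow-up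

Topic `Literature/AlgebraicGeometry/Motives`; theorem-only. For `k`-schemes `X₁, X₂` and ideal
sheaves `K₁ ⊆ 𝒪_{X₁}`, `K₂ ⊆ 𝒪_{X₂}` we study the ideal sheaf
`𝓘 = pr₁⁻¹K₁ · 𝒪 + pr₂⁻¹K₂ · 𝒪` on `X₁ ⊗ X₂ = pullback X₁.hom X₂.hom`, the ideal of the product
`V(K₁) × V(K₂)` of the two closed subschemes — the shape of the centre
`Xʳₘ × X⁰ₘ = {x_{r+2} = 0} × {y₂ = 0} ⊂ Xʳ⁺¹ₘ × X¹ₘ` of Shioda–Katsura's blow-up (Tôhoku Math. J. 31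
(1979), §1 (1.4)–(1.6), Lemma 1.2):

* `support_tensorCentre` — `V(𝓘) = pr₁⁻¹V(K₁) ∩ pr₂⁻¹V(K₂)`;
* `exists_chart_tensorCentre` — over product charts `U × V` with `K₁(U) = (u)`, `K₂(V) = (v)`
  principal with nonzerodivisor generators: `𝓘(U × V) = (pr₁^*u, pr₂^*v)`, a **regular pair**
  (`Motives/TensorRegularPair`) — the input of `Resolution/BlowupRegularPairCharts`;
* `isRegular_subscheme_tensorCentre` — if `Kᵢ = ker gᵢ` for closed immersions `gᵢ : Yᵢ ↪ Xᵢ` from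
  smooth `k`-schemes, `V(𝓘)` is a regular scheme (its chart rings are
  `(A ⊗ B)/(K₁(U) ⊗ 1 + 1 ⊗ K₂(V)) ≅ Γ(Y₁, g₁⁻¹U) ⊗ₖ Γ(Y₂, g₂⁻¹V)`, coordinate rings of the smooth
  `Y₁ ⊗ Y₂`; Mathlib `Algebra.TensorProduct.map_ker`);
* `exists_isBlowup_tensorCentre_isSmoothProjective` — for `Xᵢ` smooth projective, the blow-up of
  `X₁ ⊗ X₂` along `𝓘` is smooth projective of the same dimension, birational, an isomorphism off
  `V(𝓘)` (`Resolution/BlowupSmoothProjective`; Hartshorne II 7.16, 8.24).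

## References

* T. Shioda, T. Katsura, On Fermat varieties, Tôhoku Math. J. 31 (1979) 97–115, §1 (1.4)–(1.6),
  Lemma 1.2, Thm. 1.7. [ShiodaKatsura1979]
* R. Hartshorne, *Algebraic Geometry* (1977), II Thm. 3.3, II Prop. 7.16, II Thm. 8.24.
  [Hartshorne1977]
-/

noncomputable section

open CategoryTheory CategoryTheory.Limits AlgebraicGeometry TensorProduct

namespace Literature.AlgebraicGeometry.Motives

open Literature.AlgebraicGeometry.Resolution

/-! ### Algebra: `(A ⊗ B)/(ker f₁ ⊗ 1 + 1 ⊗ ker f₂) ≅ A' ⊗ B'` -/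

section Algebra

variable {k : Type*} [CommRing k] {A B A' B' : Type*} [CommRing A] [CommRing B] [CommRing A']
  [CommRing B'] [Algebra k A] [Algebra k B] [Algebra k A'] [Algebra k B']

/-- **`(A ⊗ B)/(ker f₁ · (A ⊗ B) + ker f₂ · (A ⊗ B)) ≅ A' ⊗ B'`** for surjective `k`-algebra maps
`f₁ : A → A'`, `f₂ : B → B'` (right exactness of `⊗`, Mathlib `Algebra.TensorProduct.map_ker`),
with `a ⊗ b ↦ f₁ a ⊗ f₂ b`. [folklore] -/
theorem exists_ringEquiv_quotient_sup_map_ker (f₁ : A →ₐ[k] A') (f₂ : B →ₐ[k] B')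
    (h₁ : Function.Surjective f₁) (h₂ : Function.Surjective f₂) :
    ∃ e : ((A ⊗[k] B) ⧸ ((RingHom.ker f₁).map
        (Algebra.TensorProduct.includeLeft : A →ₐ[k] A ⊗[k] B) ⊔
          (RingHom.ker f₂).map (Algebra.TensorProduct.includeRight : B →ₐ[k] A ⊗[k] B))) ≃+*
        A' ⊗[k] B',
      ∀ a b, e (Ideal.Quotient.mk _ (a ⊗ₜ b)) = f₁ a ⊗ₜ f₂ b := by
  have hsurj : Function.Surjective (Algebra.TensorProduct.map f₁ f₂) :=
    Algebra.TensorProduct.map_surjective _ _ h₁ h₂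
  have hker := Algebra.TensorProduct.map_ker f₁ f₂ h₁ h₂
  refine ⟨(Ideal.quotEquivOfEq hker.symm).trans
    (Ideal.quotientKerAlgEquivOfSurjective hsurj).toRingEquiv, fun a b ↦ ?_⟩
  rw [RingEquiv.trans_apply, Ideal.quotEquivOfEq_mk]
  change Ideal.quotientKerAlgEquivOfSurjective hsurj (Ideal.Quotient.mk _ (a ⊗ₜ b)) = _
  rw [Ideal.quotientKerAlgEquivOfSurjective_mk]
  rfl

end Algebra

/-! ### `k`-linearity of pull-back along a `k`-morphism on affine opens -/

section Linear

variable {k : Type} [Field k] {X Y : SchemeOver k} (g : Y ⟶ X) [IsAffineHom g.left]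
  {U : X.left.Opens} (hU : IsAffineOpen U)

/-- For a `k`-morphism `g : Y → X` and an affine open `U ⊆ X`, the pull-back
`g^* : Γ(X, U) → Γ(Y, g⁻¹U)` is compatible with the `k`-algebra structure maps
(`affineOpenStructureHom`): both sides have `Spec` equal to `Spec Γ(Y, g⁻¹U) → Y → Spec k`.
[folklore] -/
theorem affineOpenStructureHom_comp_app :
    affineOpenStructureHom X hU ≫ g.left.app U = affineOpenStructureHom Y (hU.preimage g.left) := by
  apply Spec.map_injective
  rw [Spec.map_comp, Spec_map_affineOpenStructureHom, Spec_map_affineOpenStructureHom,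
    Scheme.Hom.app_eq_appLE, IsAffineOpen.SpecMap_appLE_fromSpec_assoc _ hU (hU.preimage g.left),
    ← Over.w g]

/-- The pull-back `g^* : Γ(X, U) → Γ(Y, g⁻¹U)` as a `k`-algebra map (for the structures
`affineOpenAlgebra`). [folklore] -/
theorem exists_algHom_app :
    letI := affineOpenAlgebra X hU
    letI := affineOpenAlgebra Y (hU.preimage g.left)
    ∃ f : Γ(X.left, U) →ₐ[k] Γ(Y.left, g.left ⁻¹ᵁ U), f.toRingHom = (g.left.app U).hom := by
  letI := affineOpenAlgebra X hU
  letI := affineOpenAlgebra Y (hU.preimage g.left)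
  refine ⟨{ (g.left.app U).hom with commutes' := fun c ↦ ?_ }, rfl⟩
  change (affineOpenStructureHom X hU ≫ g.left.app U) c = affineOpenStructureHom Y _ c
  rw [affineOpenStructureHom_comp_app]

end Linear

/-! ### The product centre -/

section Centre

variable {k : Type} [Field k] (X₁ X₂ : SchemeOver k) (K₁ : X₁.left.IdealSheafData)
  (K₂ : X₂.left.IdealSheafData)

/-! The ideal sheaf of the product centre on `X₁ ⊗ X₂ = pullback X₁.hom X₂.hom` is written
out as `K₁.comap (pullback.fst X₁.hom X₂.hom) ⊔ K₂.comap (pullback.snd X₁.hom X₂.hom)`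
(`𝓘 = pr₁⁻¹K₁ · 𝒪 + pr₂⁻¹K₂ · 𝒪`) in all statements below. -/

/-- **`V(𝓘) = pr₁⁻¹ V(K₁) ∩ pr₂⁻¹ V(K₂)`** (supports of sums and inverse images of ideal sheaves).
[folklore] -/
theorem support_tensorCentre :
    ((K₁.comap (pullback.fst X₁.hom X₂.hom) ⊔ K₂.comap (pullback.snd X₁.hom X₂.hom)).support : Set ↑(pullback X₁.hom X₂.hom)) =
      (pullback.fst X₁.hom X₂.hom) ⁻¹' (K₁.support : Set X₁.left) ∩
        (pullback.snd X₁.hom X₂.hom) ⁻¹' (K₂.support : Set X₂.left) := by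
  rw [Scheme.IdealSheafData.support_sup, Scheme.IdealSheafData.support_comap,
    Scheme.IdealSheafData.support_comap]
  rfl

/-- A ring isomorphism transports divisibility back. [folklore] -/
theorem dvd_of_ringEquiv {S T : Type*} [CommRing S] [CommRing T] (e : S ≃+* T) {x y : S}
    (h : e x ∣ e y) : x ∣ y := by
  simpa using map_dvd e.symm h

/-- **The product centre on a product chart is a complete intersection of a regular pair.** Let
`U ⊆ X₁`, `V ⊆ X₂` be affine opens on which `K₁(U) = (u)`, `K₂(V) = (v)` with nonzerodivisors
`u, v`. Then on the affine open `W = U × V` of `X₁ ⊗ X₂`: `𝓘(W) = (pr₁^*u, pr₂^*v)`, both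
generators are nonzerodivisors, and each is a nonzerodivisor modulo the other
(`Γ(W) = Γ(U) ⊗ₖ Γ(V)`, `Motives/TensorAffineOpenChart`, `Motives/TensorRegularPair`). This is
the hypothesis of `Resolution/BlowupRegularPairCharts` for the blow-up along `𝓘`; for
Shioda–Katsura, `u = x_{r+2}/xᵢ`, `v = y₂/y_l` (Tôhoku Math. J. 31 (1979), §1 (1.4)).
[cite: ShiodaKatsura1979, §1 (1.4) and Lemma 1.2] [cite: Hartshorne1977, II Thm. 3.3] -/
theorem exists_chart_tensorCentre {U : X₁.left.Opens} (hU : IsAffineOpen U) {V : X₂.left.Opens}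
    (hV : IsAffineOpen V) (u : Γ(X₁.left, U)) (v : Γ(X₂.left, V))
    (hKu : K₁.ideal ⟨U, hU⟩ = Ideal.span {u}) (hKv : K₂.ideal ⟨V, hV⟩ = Ideal.span {v})
    (hu : u ∈ nonZeroDivisors Γ(X₁.left, U)) (hv : v ∈ nonZeroDivisors Γ(X₂.left, V)) :
    ∃ (W : (pullback X₁.hom X₂.hom).Opens) (hW : IsAffineOpen W)
      (hWU : W ≤ pullback.fst X₁.hom X₂.hom ⁻¹ᵁ U) (hWV : W ≤ pullback.snd X₁.hom X₂.hom ⁻¹ᵁ V),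
      (W : Set ↑(pullback X₁.hom X₂.hom)) = (pullback.fst X₁.hom X₂.hom) ⁻¹' (U : Set X₁.left) ∩
        (pullback.snd X₁.hom X₂.hom) ⁻¹' (V : Set X₂.left) ∧
      (K₁.comap (pullback.fst X₁.hom X₂.hom) ⊔ K₂.comap (pullback.snd X₁.hom X₂.hom)).ideal ⟨W, hW⟩ = Ideal.span {(pullback.fst X₁.hom X₂.hom).appLE U W hWU u,
        (pullback.snd X₁.hom X₂.hom).appLE V W hWV v} ∧
      (pullback.fst X₁.hom X₂.hom).appLE U W hWU u ∈ nonZeroDivisors Γ(pullback X₁.hom X₂.hom, W) ∧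
      (pullback.snd X₁.hom X₂.hom).appLE V W hWV v ∈ nonZeroDivisors Γ(pullback X₁.hom X₂.hom, W) ∧
      (∀ r, (pullback.fst X₁.hom X₂.hom).appLE U W hWU u ∣
          r * (pullback.snd X₁.hom X₂.hom).appLE V W hWV v →
        (pullback.fst X₁.hom X₂.hom).appLE U W hWU u ∣ r) ∧
      (∀ r, (pullback.snd X₁.hom X₂.hom).appLE V W hWV v ∣
          r * (pullback.fst X₁.hom X₂.hom).appLE U W hWU u →
        (pullback.snd X₁.hom X₂.hom).appLE V W hWV v ∣ r) := by
  letI := affineOpenAlgebra X₁ hU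
  letI := affineOpenAlgebra X₂ hV
  obtain ⟨W, hW, hWU, hWV, e, hset, hfst, hsnd⟩ := exists_ringEquiv_tensorAffineOpen X₁ X₂ hU hV
  have hu' := TensorRegularPair.tmul_one_mem_nonZeroDivisors (k := k) (B := Γ(X₂.left, V)) hu
  have hv' := TensorRegularPair.one_tmul_mem_nonZeroDivisors (k := k) (A := Γ(X₁.left, U)) hv
  refine ⟨W, hW, hWU, hWV, hset, ?_, ?_, ?_, ?_, ?_⟩
  · change ((Scheme.IdealSheafData.comap K₁ (pullback.fst X₁.hom X₂.hom)).ideal ⊔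
      (Scheme.IdealSheafData.comap K₂ (pullback.snd X₁.hom X₂.hom)).ideal) ⟨W, hW⟩ = _
    rw [Pi.sup_apply, ideal_comap_of_le (pullback.fst X₁.hom X₂.hom) K₁ ⟨U, hU⟩ ⟨W, hW⟩ hWU,
      ideal_comap_of_le (pullback.snd X₁.hom X₂.hom) K₂ ⟨V, hV⟩ ⟨W, hW⟩ hWV, hKu, hKv,
      Ideal.map_span, Ideal.map_span, Set.image_singleton, Set.image_singleton, Ideal.span_insert]
  · exact mem_nonZeroDivisors_of_map_ringEquiv e (by rw [hfst]; exact hu')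
  · exact mem_nonZeroDivisors_of_map_ringEquiv e (by rw [hsnd]; exact hv')
  · intro r hr
    refine dvd_of_ringEquiv e ?_
    rw [hfst]
    refine TensorRegularPair.dvd_of_tmul_one_dvd_mul_one_tmul u hv (e r) ?_
    have := map_dvd e hr
    rwa [map_mul, hfst, hsnd] at this
  · intro r hr
    refine dvd_of_ringEquiv e ?_
    rw [hsnd]
    refine TensorRegularPair.dvd_of_one_tmul_dvd_mul_tmul_one hu v (e r) ?_
    have := map_dvd e hr
    rwa [map_mul, hfst, hsnd] at this

/-- On a product chart, `𝓘(U × V) = K₁(U) · Γ + K₂(V) · Γ`. [folklore] -/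
theorem ideal_tensorCentre_eq_sup {U : X₁.left.Opens} (hU : IsAffineOpen U) {V : X₂.left.Opens}
    (hV : IsAffineOpen V) {W : (pullback X₁.hom X₂.hom).Opens} (hW : IsAffineOpen W)
    (hWU : W ≤ pullback.fst X₁.hom X₂.hom ⁻¹ᵁ U) (hWV : W ≤ pullback.snd X₁.hom X₂.hom ⁻¹ᵁ V) :
    (K₁.comap (pullback.fst X₁.hom X₂.hom) ⊔ K₂.comap (pullback.snd X₁.hom X₂.hom)).ideal ⟨W, hW⟩ = (K₁.ideal ⟨U, hU⟩).map ((pullback.fst X₁.hom X₂.hom).appLE U W hWU).hom ⊔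
      (K₂.ideal ⟨V, hV⟩).map ((pullback.snd X₁.hom X₂.hom).appLE V W hWV).hom := by
  change ((Scheme.IdealSheafData.comap K₁ (pullback.fst X₁.hom X₂.hom)).ideal ⊔
    (Scheme.IdealSheafData.comap K₂ (pullback.snd X₁.hom X₂.hom)).ideal) ⟨W, hW⟩ = _
  rw [Pi.sup_apply, ideal_comap_of_le (pullback.fst X₁.hom X₂.hom) K₁ ⟨U, hU⟩ ⟨W, hW⟩ hWU,
    ideal_comap_of_le (pullback.snd X₁.hom X₂.hom) K₂ ⟨V, hV⟩ ⟨W, hW⟩ hWV]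

/-- **The product of two smooth closed subschemes is a regular closed subscheme**: if
`Kᵢ = ker gᵢ` for closed `k`-immersions `gᵢ : Yᵢ ↪ Xᵢ` with `Yᵢ → Spec k` smooth, then the closed
subscheme `V(𝓘) = Y₁ × Y₂` of `X₁ ⊗ X₂` is regular: its coordinate ring over a product chart
`U × V` is `(Γ(U) ⊗ Γ(V))/(K₁(U) ⊗ 1 + 1 ⊗ K₂(V)) ≅ Γ(Y₁, g₁⁻¹U) ⊗ₖ Γ(Y₂, g₂⁻¹V)`
(`Algebra.TensorProduct.map_ker`), a coordinate ring of the smooth, hence regular, `Y₁ ⊗ Y₂`.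
For Shioda–Katsura: `Xʳₘ × X⁰ₘ ⊂ Xʳ⁺¹ₘ × X¹ₘ` (Tôhoku Math. J. 31 (1979), Lemma 1.2).
[cite: ShiodaKatsura1979, §1 Lemma 1.2] [cite: Hartshorne1977, II Thm. 8.24 (hypotheses)] -/
theorem isRegular_subscheme_tensorCentre {Y₁ Y₂ : SchemeOver k} (g₁ : Y₁ ⟶ X₁) (g₂ : Y₂ ⟶ X₂)
    [IsClosedImmersion g₁.left] [IsClosedImmersion g₂.left] {n₁ n₂ : ℕ}
    [SmoothOfRelativeDimension n₁ Y₁.hom] [SmoothOfRelativeDimension n₂ Y₂.hom]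
    (hK₁ : K₁ = g₁.left.ker) (hK₂ : K₂ = g₂.left.ker) : Scheme.IsRegular (K₁.comap (pullback.fst X₁.hom X₂.hom) ⊔ K₂.comap (pullback.snd X₁.hom X₂.hom)).subscheme := by
  -- `S = Y₁ ⊗ Y₂` is regular and locally Noetherian
  haveI hsm : SmoothOfRelativeDimension (n₁ + n₂) (pullback.fst Y₁.hom Y₂.hom ≫ Y₁.hom) :=
    smoothOfRelativeDimension_tensor (X := Y₁) (Y := Y₂) (n := n₁) (m := n₂)
  have hS : Scheme.IsRegular (pullback Y₁.hom Y₂.hom) := fun y ↦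
    isRegularLocalRing_stalk_of_smoothOfRelativeDimension (pullback.fst Y₁.hom Y₂.hom ≫ Y₁.hom)
      (n₁ + n₂) y
  haveI : Smooth (pullback.fst Y₁.hom Y₂.hom ≫ Y₁.hom) :=
    SmoothOfRelativeDimension.smooth (n := n₁ + n₂) (f := pullback.fst Y₁.hom Y₂.hom ≫ Y₁.hom)
  haveI : IsLocallyNoetherian (pullback Y₁.hom Y₂.hom) :=
    LocallyOfFiniteType.isLocallyNoetherian (pullback.fst Y₁.hom Y₂.hom ≫ Y₁.hom)
  refine Scheme.IsRegular.of_forall_exists_isOpenImmersion fun x ↦ ?_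
  -- a product chart `W = U × V` around the image `z` of `x`
  obtain ⟨U, hU, hzU, -⟩ := exists_isAffineOpen_mem_and_subset
    (x := pullback.fst X₁.hom X₂.hom ((K₁.comap (pullback.fst X₁.hom X₂.hom) ⊔ K₂.comap (pullback.snd X₁.hom X₂.hom)).subschemeι x)) (U := ⊤) trivial
  obtain ⟨V, hV, hzV, -⟩ := exists_isAffineOpen_mem_and_subset
    (x := pullback.snd X₁.hom X₂.hom ((K₁.comap (pullback.fst X₁.hom X₂.hom) ⊔ K₂.comap (pullback.snd X₁.hom X₂.hom)).subschemeι x)) (U := ⊤) trivial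
  letI := affineOpenAlgebra X₁ hU
  letI := affineOpenAlgebra X₂ hV
  letI := affineOpenAlgebra Y₁ (hU.preimage g₁.left)
  letI := affineOpenAlgebra Y₂ (hV.preimage g₂.left)
  obtain ⟨W, hW, hWU, hWV, e, hset, hfst, hsnd⟩ := exists_ringEquiv_tensorAffineOpen X₁ X₂ hU hV
  have hzW : (K₁.comap (pullback.fst X₁.hom X₂.hom) ⊔ K₂.comap (pullback.snd X₁.hom X₂.hom)).subschemeι x ∈ W := by
    rw [← SetLike.mem_coe, hset]
    exact ⟨hzU, hzV⟩
  refine ⟨_, (K₁.comap (pullback.fst X₁.hom X₂.hom) ⊔ K₂.comap (pullback.snd X₁.hom X₂.hom)).subschemeCover.f ⟨W, hW⟩, inferInstance, ?_, ?_⟩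
  · rw [← Scheme.Hom.coe_opensRange, Scheme.IdealSheafData.opensRange_subschemeCover_map]
    exact hzW
  -- the chart ring `Γ(W)/𝓘(W) ≅ Γ(Y₁, g₁⁻¹U) ⊗ Γ(Y₂, g₂⁻¹V) ≅ Γ(Y₁ ⊗ Y₂, g₁⁻¹U × g₂⁻¹V)`
  obtain ⟨f₁, hf₁⟩ := exists_algHom_app g₁ hU
  obtain ⟨f₂, hf₂⟩ := exists_algHom_app g₂ hV
  have hf₁s : Function.Surjective f₁ := fun y ↦ by
    obtain ⟨a, ha⟩ := g₁.left.app_surjective U hU y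
    exact ⟨a, by rw [← ha]; exact congrFun (congrArg DFunLike.coe hf₁) a⟩
  have hf₂s : Function.Surjective f₂ := fun y ↦ by
    obtain ⟨a, ha⟩ := g₂.left.app_surjective V hV y
    exact ⟨a, by rw [← ha]; exact congrFun (congrArg DFunLike.coe hf₂) a⟩
  obtain ⟨e₃, -⟩ := exists_ringEquiv_quotient_sup_map_ker f₁ f₂ hf₁s hf₂s
  obtain ⟨W', hW', -, -, e₄, -, -, -⟩ := exists_ringEquiv_tensorAffineOpen Y₁ Y₂
    (hU.preimage g₁.left) (hV.preimage g₂.left)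
  haveI : IsRegularRing Γ(pullback Y₁.hom Y₂.hom, W') := hS.isRegularRing_of_isAffineOpen hW'
  -- `e(𝓘(W)) = ker f₁ ⊗ 1 + 1 ⊗ ker f₂`
  have hK₁U : K₁.ideal ⟨U, hU⟩ = RingHom.ker f₁ := by
    rw [hK₁, Scheme.Hom.ker_apply]
    exact congrArg RingHom.ker hf₁.symm
  have hK₂V : K₂.ideal ⟨V, hV⟩ = RingHom.ker f₂ := by
    rw [hK₂, Scheme.Hom.ker_apply]
    exact congrArg RingHom.ker hf₂.symm
  have h1 : (e : Γ(pullback X₁.hom X₂.hom, W) →+* _).comp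
      ((pullback.fst X₁.hom X₂.hom).appLE U W hWU).hom =
        (Algebra.TensorProduct.includeLeft (R := k) (S := k) (A := Γ(X₁.left, U))
          (B := Γ(X₂.left, V))).toRingHom := RingHom.ext hfst
  have h2 : (e : Γ(pullback X₁.hom X₂.hom, W) →+* _).comp
      ((pullback.snd X₁.hom X₂.hom).appLE V W hWV).hom =
        (Algebra.TensorProduct.includeRight (R := k) (A := Γ(X₁.left, U))
          (B := Γ(X₂.left, V))).toRingHom := RingHom.ext hsnd
  have hJ : (RingHom.ker f₁).map (Algebra.TensorProduct.includeLeft :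
        Γ(X₁.left, U) →ₐ[k] Γ(X₁.left, U) ⊗[k] Γ(X₂.left, V)) ⊔
      (RingHom.ker f₂).map (Algebra.TensorProduct.includeRight :
        Γ(X₂.left, V) →ₐ[k] Γ(X₁.left, U) ⊗[k] Γ(X₂.left, V)) =
      ((K₁.comap (pullback.fst X₁.hom X₂.hom) ⊔ K₂.comap (pullback.snd X₁.hom X₂.hom)).ideal ⟨W, hW⟩).map (e : Γ(pullback X₁.hom X₂.hom, W) →+* _) := by
    rw [ideal_tensorCentre_eq_sup X₁ X₂ K₁ K₂ hU hV hW hWU hWV, Ideal.map_sup, Ideal.map_map,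
      Ideal.map_map, h1, h2, hK₁U, hK₂V]
    rfl
  let e₂ := Ideal.quotientEquiv _ _ e hJ
  haveI : IsRegularRing (Γ(pullback X₁.hom X₂.hom, W) ⧸ (K₁.comap (pullback.fst X₁.hom X₂.hom) ⊔ K₂.comap (pullback.snd X₁.hom X₂.hom)).ideal ⟨W, hW⟩) :=
    IsRegularRing.of_ringEquiv (e₄.trans (e₃.symm.trans e₂.symm))
  exact Scheme.isRegular_Spec (.of (Γ(pullback X₁.hom X₂.hom, W) ⧸ (K₁.comap (pullback.fst X₁.hom X₂.hom) ⊔ K₂.comap (pullback.snd X₁.hom X₂.hom)).ideal ⟨W, hW⟩))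

/-- A non-empty `k`-scheme surjects onto `Spec k` (file-local copy of
`Motives.surjective_hom_of_nonempty` of `TheoremOfCubeFormalLiftProofs`, not imported here).
[folklore] -/
private theorem surjective_hom_of_nonempty' (X : SchemeOver k) [Nonempty X.left] : Surjective X.hom :=
  ⟨fun _ ↦ ⟨Classical.arbitrary X.left, Subsingleton.elim (α := PrimeSpectrum k) _ _⟩⟩

/-- `𝓘 ≠ 0`: if `V(K₁) ≠ X₁` (and `X₂ ≠ ∅`) then `V(𝓘) ≠ X₁ ⊗ X₂`. [folklore] -/
theorem tensorCentre_ne_bot [Nonempty X₂.left] (hne : (K₁.support : Set X₁.left) ≠ Set.univ) :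
    (K₁.comap (pullback.fst X₁.hom X₂.hom) ⊔ K₂.comap (pullback.snd X₁.hom X₂.hom)) ≠ ⊥ := by
  intro h
  apply hne
  have hsupp := support_tensorCentre X₁ X₂ K₁ K₂
  rw [h, Scheme.IdealSheafData.support_bot] at hsupp
  haveI := surjective_hom_of_nonempty' X₂
  refine Set.eq_univ_of_forall fun x₁ ↦ ?_
  obtain ⟨z, rfl⟩ := (pullback.fst X₁.hom X₂.hom).surjective x₁
  have hz : z ∈ ((⊤ : TopologicalSpace.Closeds ↑(pullback X₁.hom X₂.hom)) :
    Set ↑(pullback X₁.hom X₂.hom)) := trivial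
  rw [hsupp] at hz
  exact hz.1

/-- **The blow-up of `X₁ ⊗ X₂` along the product `Y₁ × Y₂` of two smooth closed subschemes is
smooth projective** of dimension `n₁ + n₂`, birational, an isomorphism off `Y₁ × Y₂` (for `Xᵢ`
smooth projective of dimension `nᵢ`, `gᵢ : Yᵢ ↪ Xᵢ` closed immersions with `Yᵢ` smooth over
`k` and `Y₁ ≠ X₁`): `Resolution/BlowupSmoothProjective.exists_isBlowup_isSmoothProjective` with
the regular centre `isRegular_subscheme_tensorCentre`. For Shioda–Katsura this is the blow-up
`Z = Q_{Xʳₘ × X⁰ₘ}(Xʳ⁺¹ₘ × X¹ₘ)` of Thm. 1.7 ((1.6), (1.25)).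
[cite: ShiodaKatsura1979, §1 (1.6), Thm. 1.7] [cite: Hartshorne1977, II Prop. 7.16 and Thm. 8.24] -/
theorem exists_isBlowup_tensorCentre_isSmoothProjective {n₁ n₂ : ℕ}
    (hX₁ : IsSmoothProjective n₁ X₁) (hX₂ : IsSmoothProjective n₂ X₂) {Y₁ Y₂ : SchemeOver k}
    (g₁ : Y₁ ⟶ X₁) (g₂ : Y₂ ⟶ X₂) [IsClosedImmersion g₁.left] [IsClosedImmersion g₂.left]
    {d₁ d₂ : ℕ} [SmoothOfRelativeDimension d₁ Y₁.hom] [SmoothOfRelativeDimension d₂ Y₂.hom]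
    [IsAlgClosed k] (hK₁ : K₁ = g₁.left.ker) (hK₂ : K₂ = g₂.left.ker)
    (hne : (K₁.support : Set X₁.left) ≠ Set.univ) :
    ∃ (X' : SchemeOver k) (bb : X' ⟶ MonoidalCategory.tensorObj X₁ X₂), IsBlowup bb.left (K₁.comap (pullback.fst X₁.hom X₂.hom) ⊔ K₂.comap (pullback.snd X₁.hom X₂.hom)) ∧
      IsSmoothProjective (n₁ + n₂) X' ∧ IsBirational bb.left ∧ IsIso (bb.left ∣_ centreCompl (K₁.comap (pullback.fst X₁.hom X₂.hom) ⊔ K₂.comap (pullback.snd X₁.hom X₂.hom))) := by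
  haveI : IsIntegral X₂.left := IsSmoothProjective.isIntegral_holds hX₂
  exact exists_isBlowup_isSmoothProjective (X := MonoidalCategory.tensorObj X₁ X₂)
    (IsSmoothProjective.tensor_holds hX₁ hX₂)
    (tensorCentre_ne_bot X₁ X₂ K₁ K₂ hne)
    (isRegular_subscheme_tensorCentre X₁ X₂ K₁ K₂ g₁ g₂ (n₁ := d₁) (n₂ := d₂) hK₁ hK₂)

end Centre

end Literature.AlgebraicGeometry.Motives

end
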